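import Mathlib
import HarnessLib
import Literature.MathematicalPhysics.QuantumFieldTheory.OSSectorContinuation
import Literature.MathematicalPhysics.QuantumFieldTheory.OSReconstructionNoE1Proofs
import Summits.QuantumFields.YangMills.Theorems.MirrorModularBoostsPlanarSpectralConeFrontEnd
import Literature.MathematicalPhysics.QuantumFieldTheory.OSHolomorphicVectors
import Summits.QuantumFields.YangMills.Theorems.MirrorModularBoostsPlanarSpectralConeOneGapSector
import Summits.QuantumFields.YangMills.Theorems.MirrorModularBoostsPlanarSpectralConeDiscSections
import Summits.QuantumFields.YangMills.Theorems.MirrorModularBoostsPlanarSpectralConeDensityOfParts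
import Summits.QuantumFields.YangMills.Theorems.MirrorModularBoostsPlanarSpectralConeWindowedDensity
import Summits.QuantumFields.YangMills.Theorems.MirrorModularBoostsPlanarSpectralConeTransfer
import Summits.QuantumFields.YangMills.Theorems.MirrorModularBoostsPlanarSpectralConeDelayedLever
import Summits.QuantumFields.YangMills.Theorems.MirrorModularBoostsPlanarSpectralConeSpanLinearity

/-!
PROVENANCE.  Strategist-written candidate proof (planner-cstrat-stmt-QuantumFields-9910-r1-0, 2026-08-17; tree copy
`Summits/QuantumFields/QCD/Cruxes/LabelledPlanarSpectralCone/Proof.lean`, 1499 lines, lean check rc 0 / 0 sorries / 0 warnings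
against the tree of 2026-08-28), landed VERBATIM in ≤ 400-line parts under `Theorems/` by width seat ym-t4-w17 g0 (free hands):
parts `…LabelledConeDiscSections` (X₁), `…LabelledConeChainDensity{Kinematics,Sector,OneGap,}` (X₂), `…LabelledPlanarSpectralConeSplit`
(glue), and the by-name closers `…Holds`.  Statements are INLINE (no route import), so these parts are route-independent.
-/

noncomputable section

namespace Summit.QuantumFields.QCD.Theorems.LabelledConeChainDensityProof

open MeasureTheory Complex Set Filter
open scoped InnerProductSpace SchwartzMap ComplexConjugate Topology
open Literature.MathematicalPhysics.QuantumLattice Literature.MathematicalPhysics.AQFT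
  Literature.MathematicalPhysics.QuantumFieldTheory
open Summit.QuantumFields.YangMills.Cruxes.PlanarSpectralCone.PositivityDiscToOperatorCone
open Summit.QuantumFields.YangMills.Cruxes.PlanarSpectralCone.PositivityDiscToOperatorCone.OneGap
open Literature.Analysis.Complex


namespace OneGapL

/-! ### A. Labelled kinematics: arity casts with label strings, the re-centred pairing identity -/

/-- A labelled family does not see an arity cast `Fin N = Fin N'` once the label string is transported. -/
theorem apply_cast_arity_labelled {ι : Type} (S : LabelledSchwingerFamily ι (EuclideanSpace ℝ (Fin 4))) {N N' : ℕ} (hN : N = N')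
    (κ : Fin N' → ι) (G : 𝓢((Fin N → (EuclideanSpace ℝ (Fin 4))), ℂ)) :
    S N' κ (cast (congrArg (fun M => 𝓢((Fin M → (EuclideanSpace ℝ (Fin 4))), ℂ)) hN) G) = S N (κ ∘ Fin.cast hN) G := by
  subst hN; rfl

/-- **Label bookkeeping for the re-centring.** Reading the label string `rev κ ++ κ` of
`Θ(P ⊗ Q_s)* ⊗ (P ⊗ Q_{s'})` through the arity cast `(k+l)+(k+l) = l+(k+(k+l))` gives the label string
`rev κ_Q ++ (rev κ_P ++ κ)` of `ΘQ'* ⊗ R(s')`, where `κ_P = κ ∘ castAdd l`, `κ_Q = κ ∘ natAdd k`. -/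
theorem labels_recentre {ι : Type} {k l : ℕ} (κ : Fin (k + l) → ι)
    (hN : (k + l) + (k + l) = l + (k + (k + l))) :
    (Fin.append ((fun j : Fin l => κ (Fin.natAdd k j)) ∘ Fin.rev)
        (Fin.append ((fun i : Fin k => κ (Fin.castAdd l i)) ∘ Fin.rev) κ)) ∘ Fin.cast hN =
      Fin.append (κ ∘ Fin.rev) κ := by
  -- the four index identities (values in `Fin (l + (k + (k + l)))`)
  have I1 : ∀ i : Fin k, Fin.cast hN (Fin.castAdd (k + l) (Fin.castAdd l i).rev) =
      Fin.natAdd l (Fin.castAdd (k + l) i.rev) := fun i => by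
    apply Fin.ext; simp only [Fin.val_cast, Fin.val_castAdd, Fin.val_rev, Fin.val_natAdd]; omega
  have I2 : ∀ i : Fin l, Fin.cast hN (Fin.castAdd (k + l) (Fin.natAdd k i).rev) =
      Fin.castAdd (k + (k + l)) i.rev := fun i => by
    apply Fin.ext; simp only [Fin.val_cast, Fin.val_castAdd, Fin.val_rev, Fin.val_natAdd]; omega
  have I3 : ∀ i : Fin k, Fin.cast hN (Fin.natAdd (k + l) (Fin.castAdd l i)) =
      Fin.natAdd l (Fin.natAdd k (Fin.castAdd l i)) := fun i => by
    apply Fin.ext; simp only [Fin.val_cast, Fin.val_castAdd, Fin.val_natAdd]; omega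
  have I4 : ∀ i : Fin l, Fin.cast hN (Fin.natAdd (k + l) (Fin.natAdd k i)) =
      Fin.natAdd l (Fin.natAdd k (Fin.natAdd k i)) := fun i => by
    apply Fin.ext; simp only [Fin.val_cast, Fin.val_natAdd]; omega
  funext x
  simp only [Function.comp_apply]
  induction x using Fin.addCases with
  | left i =>
    -- `x = castAdd (k+l) i`; write `i = j.rev` and split `j`
    obtain ⟨j, rfl⟩ : ∃ j : Fin (k + l), i = j.rev := ⟨i.rev, (Fin.rev_rev i).symm⟩
    rw [Fin.append_left, Function.comp_apply, Fin.rev_rev]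
    induction j using Fin.addCases with
    | left a => rw [I1, Fin.append_right, Fin.append_left, Function.comp_apply, Fin.rev_rev]
    | right b => rw [I2, Fin.append_left, Function.comp_apply, Fin.rev_rev]
  | right i =>
    rw [Fin.append_right]
    induction i using Fin.addCases with
    | left a => rw [I3, Fin.append_right, Fin.append_right]
    | right b => rw [I4, Fin.append_right, Fin.append_right]

/-- **The re-centred pairing identity, LABELLED.** For `s ≥ 0` and a label string `κ` on the `k + l`
points of `P ⊗ Q`,
`⟪Ψ^κ_{P⊗Q_{se₀}}, Ψ^κ_{P⊗Q_{s'e₀}}⟫ = ⟪Ψ^{κ_Q}_{Q_{−Te₀}}, e^{-sH} Ψ^{rev κ_P ++ κ}_{R(s')}⟫`,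
`R(s') = (ΘP* ⊗ (P ⊗ Q_{s'e₀}))_{+Te₀}` (translation invariance on `⁰𝒮` by `(T+s)e₀`, arity cast with
`labels_recentre`). -/
theorem inner_stretch_eq_labelled {ι : Type} (S : LabelledSchwingerFamily ι (EuclideanSpace ℝ (Fin 4)))
    (h : OSReconstructionNoE1 S) {k l : ℕ} (κ : Fin (k + l) → ι)
    (P : 𝓢((Fin k → (EuclideanSpace ℝ (Fin 4))), ℂ)) (Q : 𝓢((Fin l → (EuclideanSpace ℝ (Fin 4))), ℂ))
    (T : ℝ) {s s' : ℝ} (hs : 0 ≤ s)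
    (h1 : IsTimeOrdered (P.appendTensor (translateMulti (SchwingerFamily.timeVec s) Q)))
    (h2 : IsTimeOrdered (P.appendTensor (translateMulti (SchwingerFamily.timeVec s') Q)))
    (h3 : IsTimeOrdered (translateMulti (SchwingerFamily.timeVec (-T)) Q))
    (h4 : IsTimeOrdered (translateMulti (SchwingerFamily.timeVec T)
      ((osAdjoint P).appendTensor (P.appendTensor (translateMulti (SchwingerFamily.timeVec s') Q))))) :
    ⟪h.fieldVec (k + l) κ (P.appendTensor (translateMulti (SchwingerFamily.timeVec s) Q)) h1,
      h.fieldVec (k + l) κ (P.appendTensor (translateMulti (SchwingerFamily.timeVec s') Q)) h2⟫_ℂ =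
    ⟪h.fieldVec l (fun j : Fin l => κ (Fin.natAdd k j)) (translateMulti (SchwingerFamily.timeVec (-T)) Q) h3,
      h.transfer s (h.fieldVec (k + (k + l))
        (Fin.append ((fun i : Fin k => κ (Fin.castAdd l i)) ∘ Fin.rev) κ)
        (translateMulti (SchwingerFamily.timeVec T)
          ((osAdjoint P).appendTensor (P.appendTensor (translateMulti (SchwingerFamily.timeVec s') Q)))) h4)⟫_ℂ := by
  have hN : (k + l) + (k + l) = l + (k + (k + l)) := by ring
  rw [h.inner_fieldVec_fieldVec _ _ _ _ (isAppendTensorOf_appendTensor _ _),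
    OSReconstructionNoE1.transfer_fieldVec _ hs,
    h.inner_fieldVec_fieldVec _ _ _ _ (isAppendTensorOf_recentre P Q T s s' hN),
    apply_cast_arity_labelled S hN, labels_recentre κ hN]
  exact (h.translationInvariant ((k + l) + (k + l)) _ (SchwingerFamily.timeVec (T + s)) _
    (OSReconstructionNoE1.isOffDiagonal_appendTensor_osAdjoint h1 h2)).symm

/-! ### B. Labelled temperedness bounds (any single functional `L = 𝔖_N^{lab}`) -/

/-- **The pairing is tempered** for any continuous functional `L` with E0 bound `(M, C₀)`. -/
theorem norm_apply_osAdjoint_appendTensor_le' {a b : ℕ} (L : 𝓢((Fin (a + b) → (EuclideanSpace ℝ (Fin 4))), ℂ) →L[ℂ] ℂ)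
    {M : ℕ} {C₀ : ℝ}
    (hS : ∀ F : 𝓢((Fin (a + b) → (EuclideanSpace ℝ (Fin 4))), ℂ), ‖L F‖ ≤ C₀ * schwartzNorm M F)
    (A : 𝓢((Fin a → (EuclideanSpace ℝ (Fin 4))), ℂ)) (B : 𝓢((Fin b → (EuclideanSpace ℝ (Fin 4))), ℂ)) :
    ‖L ((osAdjoint A).appendTensor B)‖ ≤
      |C₀| * (2 ^ (M + 1) * schwartzNorm M A * schwartzNorm M B) := by
  have hA := schwartzNorm_nonneg M A
  have hB := schwartzNorm_nonneg M B
  calc ‖L ((osAdjoint A).appendTensor B)‖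
      ≤ C₀ * schwartzNorm M ((osAdjoint A).appendTensor B) := hS _
    _ ≤ |C₀| * schwartzNorm M ((osAdjoint A).appendTensor B) :=
        mul_le_mul_of_nonneg_right (le_abs_self _) (schwartzNorm_nonneg _ _)
    _ ≤ |C₀| * (2 ^ (M + 1) * schwartzNorm M (osAdjoint A) * schwartzNorm M B) :=
        mul_le_mul_of_nonneg_left (schwartzNorm_appendTensor_le _ _ _) (abs_nonneg _)
    _ ≤ |C₀| * (2 ^ (M + 1) * schwartzNorm M A * schwartzNorm M B) := by
        gcongr
        exact schwartzNorm_osAdjoint_le A M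

/-- An E0 bound for a single continuous functional on `𝓢((ℝ⁴)^N)` (temperedness is automatic). -/
theorem exists_bound' {N : ℕ} (L : 𝓢((Fin N → (EuclideanSpace ℝ (Fin 4))), ℂ) →L[ℂ] ℂ) :
    ∃ (M : ℕ) (C₀ : ℝ), ∀ F : 𝓢((Fin N → (EuclideanSpace ℝ (Fin 4))), ℂ), ‖L F‖ ≤ C₀ * schwartzNorm M F := by
  classical
  obtain ⟨M, C₀, hS⟩ := SchwingerFamily.exists_bound_holds (Function.update (0 : SchwingerFamily (EuclideanSpace ℝ (Fin 4))) N L) N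
  simp only [Function.update_self] at hS
  exact ⟨M, C₀, hS⟩

/-- **The Gram kernel of the stretched pair is polynomially bounded** (any functional `L` at arity
`(k+l)+(k+l)`): `|L(Θ(P⊗Q_{se₀})* ⊗ (P⊗Q_{s'e₀}))| ≤ C ((1+|s|)(1+|s'|))^p`. -/
theorem exists_norm_kernel_le' {k l : ℕ} (L : 𝓢((Fin ((k + l) + (k + l)) → (EuclideanSpace ℝ (Fin 4))), ℂ) →L[ℂ] ℂ)
    (P : 𝓢((Fin k → (EuclideanSpace ℝ (Fin 4))), ℂ)) (Q : 𝓢((Fin l → (EuclideanSpace ℝ (Fin 4))), ℂ)) :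
    ∃ (C : ℝ) (p : ℕ), 0 ≤ C ∧ ∀ s s' : ℝ,
      ‖L ((osAdjoint (P.appendTensor (translateMulti (SchwingerFamily.timeVec s) Q))).appendTensor
        (P.appendTensor (translateMulti (SchwingerFamily.timeVec s') Q)))‖ ≤
        C * ((1 + |s|) * (1 + |s'|)) ^ p := by
  obtain ⟨M, C₀, hS⟩ := exists_bound' L
  set A : ℝ := 2 ^ (M + 1) * schwartzNorm M P * (2 ^ M * (2 * schwartzNorm M Q)) with hA
  have hA0 : 0 ≤ A := by have := schwartzNorm_nonneg M P; have := schwartzNorm_nonneg M Q; positivity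
  refine ⟨|C₀| * (2 ^ (M + 1) * A * A), M, by positivity, fun s s' => ?_⟩
  refine (norm_apply_osAdjoint_appendTensor_le' L hS _ _).trans ?_
  have h1 := schwartzNorm_stretch_le M P Q s
  have h2 := schwartzNorm_stretch_le M P Q s'
  have hs : (0 : ℝ) ≤ (1 + |s|) ^ M := by positivity
  have hs' : (0 : ℝ) ≤ (1 + |s'|) ^ M := by positivity
  have h12 : schwartzNorm M (P.appendTensor (translateMulti (SchwingerFamily.timeVec s) Q)) *
      schwartzNorm M (P.appendTensor (translateMulti (SchwingerFamily.timeVec s') Q)) ≤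
      (A * (1 + |s|) ^ M) * (A * (1 + |s'|) ^ M) :=
    mul_le_mul h1 h2 (schwartzNorm_nonneg _ _) (by positivity)
  calc |C₀| * (2 ^ (M + 1) * schwartzNorm M (P.appendTensor (translateMulti (SchwingerFamily.timeVec s) Q)) *
        schwartzNorm M (P.appendTensor (translateMulti (SchwingerFamily.timeVec s') Q)))
      ≤ |C₀| * (2 ^ (M + 1) * ((A * (1 + |s|) ^ M) * (A * (1 + |s'|) ^ M))) := by
        rw [mul_assoc (2 ^ (M + 1) : ℝ)]
        exact mul_le_mul_of_nonneg_left (mul_le_mul_of_nonneg_left h12 (by positivity)) (abs_nonneg _)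
    _ = |C₀| * (2 ^ (M + 1) * A * A) * ((1 + |s|) * (1 + |s'|)) ^ M := by rw [mul_pow]; ring

/-- **The re-centred block is polynomially bounded in norm squared** (any functional `L` at arity
`(k+(k+l))+(k+(k+l))`): `|L(ΘR(σ)* ⊗ R(σ))| ≤ C (1+|σ|)^p`. -/
theorem exists_norm_recentre_sq_le' {k l : ℕ}
    (L : 𝓢((Fin ((k + (k + l)) + (k + (k + l))) → (EuclideanSpace ℝ (Fin 4))), ℂ) →L[ℂ] ℂ)
    (P : 𝓢((Fin k → (EuclideanSpace ℝ (Fin 4))), ℂ)) (Q : 𝓢((Fin l → (EuclideanSpace ℝ (Fin 4))), ℂ)) (T : ℝ) :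
    ∃ (C : ℝ) (p : ℕ), 0 ≤ C ∧ ∀ σ : ℝ,
      ‖L ((osAdjoint (translateMulti (SchwingerFamily.timeVec T)
          ((osAdjoint P).appendTensor (P.appendTensor (translateMulti (SchwingerFamily.timeVec σ) Q))))).appendTensor
          (translateMulti (SchwingerFamily.timeVec T)
            ((osAdjoint P).appendTensor (P.appendTensor (translateMulti (SchwingerFamily.timeVec σ) Q)))))‖ ≤
        C * (1 + |σ|) ^ p := by
  obtain ⟨M, C₀, hS⟩ := exists_bound' L
  set A : ℝ := 2 ^ (M + 1) * schwartzNorm M P * (2 ^ M * (2 * schwartzNorm M Q)) with hA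
  have hA0 : 0 ≤ A := by have := schwartzNorm_nonneg M P; have := schwartzNorm_nonneg M Q; positivity
  set B : ℝ := 2 ^ M * (1 + |T|) ^ M * (2 * (2 ^ (M + 1) * schwartzNorm M P * A)) with hB
  have hB0 : 0 ≤ B := by have := schwartzNorm_nonneg M P; positivity
  have hR : ∀ σ : ℝ, schwartzNorm M (translateMulti (SchwingerFamily.timeVec T)
      ((osAdjoint P).appendTensor (P.appendTensor (translateMulti (SchwingerFamily.timeVec σ) Q)))) ≤
      B * (1 + |σ|) ^ M := by
    intro σ
    have h1 := schwartzNorm_translateMulti_le M (SchwingerFamily.timeVec T)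
      ((osAdjoint P).appendTensor (P.appendTensor (translateMulti (SchwingerFamily.timeVec σ) Q)))
    rw [norm_timeVec] at h1
    have hP := schwartzNorm_nonneg M P
    have hY : schwartzNorm M ((osAdjoint P).appendTensor
        (P.appendTensor (translateMulti (SchwingerFamily.timeVec σ) Q))) ≤
        2 ^ (M + 1) * schwartzNorm M P * (A * (1 + |σ|) ^ M) := by
      refine (schwartzNorm_appendTensor_le _ _ _).trans ?_
      refine mul_le_mul ?_ (schwartzNorm_stretch_le M P Q σ) (schwartzNorm_nonneg _ _) (by positivity)
      exact mul_le_mul_of_nonneg_left (schwartzNorm_osAdjoint_le P M) (by positivity)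
    refine h1.trans ?_
    calc 2 ^ M * (1 + |T|) ^ M * (2 * schwartzNorm M ((osAdjoint P).appendTensor
          (P.appendTensor (translateMulti (SchwingerFamily.timeVec σ) Q))))
        ≤ 2 ^ M * (1 + |T|) ^ M * (2 * (2 ^ (M + 1) * schwartzNorm M P * (A * (1 + |σ|) ^ M))) :=
          mul_le_mul_of_nonneg_left (mul_le_mul_of_nonneg_left hY (by norm_num)) (by positivity)
      _ = B * (1 + |σ|) ^ M := by ring
  refine ⟨|C₀| * (2 ^ (M + 1) * B * B), M + M, by positivity, fun σ => ?_⟩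
  refine (norm_apply_osAdjoint_appendTensor_le' L hS _ _).trans ?_
  have h1 := hR σ
  have hσ : (0 : ℝ) ≤ (1 + |σ|) ^ M := by positivity
  have h0 : (0 : ℝ) ≤ schwartzNorm M (translateMulti (SchwingerFamily.timeVec T)
      ((osAdjoint P).appendTensor (P.appendTensor (translateMulti (SchwingerFamily.timeVec σ) Q)))) :=
    schwartzNorm_nonneg _ _
  have h11 : schwartzNorm M (translateMulti (SchwingerFamily.timeVec T)
          ((osAdjoint P).appendTensor (P.appendTensor (translateMulti (SchwingerFamily.timeVec σ) Q)))) *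
        schwartzNorm M (translateMulti (SchwingerFamily.timeVec T)
          ((osAdjoint P).appendTensor (P.appendTensor (translateMulti (SchwingerFamily.timeVec σ) Q)))) ≤
      (B * (1 + |σ|) ^ M) * (B * (1 + |σ|) ^ M) :=
    mul_le_mul h1 h1 h0 (by positivity)
  calc |C₀| * (2 ^ (M + 1) * schwartzNorm M (translateMulti (SchwingerFamily.timeVec T)
          ((osAdjoint P).appendTensor (P.appendTensor (translateMulti (SchwingerFamily.timeVec σ) Q)))) *
        schwartzNorm M (translateMulti (SchwingerFamily.timeVec T)
          ((osAdjoint P).appendTensor (P.appendTensor (translateMulti (SchwingerFamily.timeVec σ) Q)))))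
      ≤ |C₀| * (2 ^ (M + 1) * ((B * (1 + |σ|) ^ M) * (B * (1 + |σ|) ^ M))) := by
        rw [mul_assoc (2 ^ (M + 1) : ℝ)]
        exact mul_le_mul_of_nonneg_left (mul_le_mul_of_nonneg_left h11 (by positivity)) (abs_nonneg _)
    _ = |C₀| * (2 ^ (M + 1) * B * B) * (1 + |σ|) ^ (M + M) := by rw [pow_add]; ring


end OneGapL

end Summit.QuantumFields.QCD.Theorems.LabelledConeChainDensityProof

end
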